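import Literature.Geometry.Kaehler.ComplexTorusGradedPoincarePairing
import Literature.Geometry.Kaehler.ComplexTorusLefschetzHodgeInvolutionsRational
import Literature.Algebra.Lie.LefschetzModuleKleimanAlgebraMatrixTranspose
import HarnessLib

/-!
# Kleiman's forms `(x, y) ↦ ∫_X x ∪ *_L y` and `∫_X x ∪ ∗y` on `H•(X; ℂ)` of a complex torus: André's Prop. 1.2, last clause —
# `L_η` and `ᶜL = *_L L_η *_L` are each other's transpose —, graded symmetry, non-degeneracy, `ℚ`-values, and the Lefschetz
# decomposition is ORTHOGONAL for them

Layer `Literature/Geometry/Kaehler`, namespace `Literature.Geometry.Kaehler.ComplexTorus`; lane `lit-hodgefound` (Track 2 foundations library),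
prover seat `lit-hodgefound-p35` (generation 51, row g51-#2; sequel of row g51-#1 `ComplexTorusGradedPoincarePairing`: the graded cup-product pairing
`B_e = poincarePairingG Φ e` on `H•(X; ℂ) = GForm E ℂ`). THEOREMS ONLY (no definition, no named fact, no instance, no notation; D-0026 net debt `0`):
Kleiman's forms are written `(poincarePairingG Φ e).compl₂ *_L` and `(poincarePairingG Φ e).compl₂ ∗` (Mathlib's `LinearMap.compl₂`:
`(B.compl₂ s) x y = B x (s y)`), `*_L = (hasLefschetzProperty_lefschetzG hη).lefschetzInvolution isZGrading_countingG`,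
`∗ = (hasLefschetzProperty_lefschetzG hη).hodgeInvolution isZGrading_countingG d`. Consumed BY NAME: p34's abstract rows
`Algebra/Lie/LefschetzModuleSelfAdjoint` (`isAdjointPair_compl₂_lefschetzInvolution` / `'`, `apply_pow_primitive_pow_primitive_eq(_zero)`),
`…KleimanAlgebraMatrixTranspose` (`matrixHom_transpose_isAdjointPair_lefschetzInvolution` / `_hodgeInvolution`), `…KleimanAlgebra`
(`lefschetzInvolution_mem_adjoin_pair_dual`), row g50-#6 (`IsNSForm.lefschetzInvolution_mem_rationalEnd`, `IsNSForm.hodgeInvolution_mem_rationalEnd`),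
p09's torus dictionary (`lefschetzG_pow_of`, `of_mem_primitiveSpace_of_mem_primitiveForms`, `dual_lefschetzG_eq_lefschetzDualG`).

## Source, VERBATIM (held `paper:doi-10-1007-bf02698643`)

Y. André, *Pour une théorie inconditionnelle des motifs*, Publ. Math. IHÉS 83 (1996) [Andre1996Motifs], Prop. 1.2 (p. 11 = p0008 L62–L66):
"Les sous-algèbres `ℚ[L, *_L]`, `ℚ[L, *_H]`, `ℚ[L, *_L L *_L]`, `ℚ[L, ᶜΛ]` de `End H*(X)` sont égales […]. De plus, ces algèbres sont canoniquement
isomorphes à une somme d'algèbres matricielles `M_{i+1}(ℚ)` indexée par les entiers `i` tels que `P^{d-i}(X) ≠ 0`. Via cet isomorphisme, la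
transposition relative à la forme bilinéaire `(x, y) ↦ ∫ x ∪ * y` correspond à la transposition des matrices, pour `* = *_L` ou `*_H`."; proof
(p. 12 = p0009 L13–L15): "Quant à la dernière assertion, il suffit de la tester sur les générateurs `L` et `*_L L *_L`. Comme ces générateurs
s'échangent par la transposition, c'est clair."; §1.1 (p. 11 = p0008 L8–L10): "le point important, qui justifie l'introduction de `*_H`, est que
cet opérateur star et `*_H` ont les mêmes propriétés de positivité sur les cycles réels de type `(p, p)`". S. L. Kleiman, *Algebraic cycles and
the Weil conjectures* (1968) [Kleiman1968AlgebraicCycles], §1.4 and §3 (the forms `⟨x, ∗y⟩`; via André). J. S. Milne, *Lefschetz classes on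
abelian varieties* (1999) [Milne1999LefschetzClasses], §5 pp. 664–665 (`∗`, Thm. 5.9).

## What is proved (`B = poincarePairingG Φ e`, `K_L = B.compl₂ *_L`, `K_∗ = B.compl₂ ∗`; `η` non-degenerate, `hη`)

* §1 EVALUATION: **`compl₂_lefschetzInvolution_of_of`** (`K_L(of k x, of k y) = ⟨x, (*_L y)_m⟩_e`, `k + m = N`), `…_of_of_of_ne` (different
  degrees are `K_L`-orthogonal), `compl₂_lefschetzInvolution_apply_lefschetzInvolution` (`K_L(w, *_L w') = B(w, w')`),
  `compl₂_lefschetzInvolution_lefschetzInvolution_apply` (`K_L(*_L w, w') = B(w, w')`), `isSelfAdjoint_compl₂_lefschetzInvolution_lefschetzInvolution`;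
  the same for `∗`.
* §2 ANDRÉ'S PROP. 1.2, LAST CLAUSE, ON THE TORUS: `isAdjointPair_compl₂_lefschetzInvolution_of_isAdjointPair` (**the `K_L`-transpose of `T` is
  `*_L Tᵗ *_L`**, `Tᵗ` the `B`-transpose), **`isAdjointPair_compl₂_lefschetzInvolution_lefschetzG_conj`** (`L_η ↦ ᶜL`),
  **`isAdjointPair_compl₂_lefschetzInvolution_conj_lefschetzG`** (`ᶜL ↦ L_η`: "ces générateurs s'échangent par la transposition"),
  `…_lefschetzDualG_conj`, `…_weylOperator_conj`, **`exists_mem_adjoin_isAdjointPair_compl₂_lefschetzInvolution`** (`ℂ[L_η, Λ_η]` is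
  `K_L`-transposition-stable), **`isAdjointPair_compl₂_lefschetzInvolution_matrixHom_transpose`** ("correspond à la transposition des matrices":
  `Φ(c)ᵀ = Φ(cᵀ)` for André's `Φ : ⊕ M_{k+1}(ℂ) → End H•(X; ℂ)`), `isSelfAdjoint_compl₂_lefschetzInvolution_matrixHom_of_isSymm`; the same for `∗`.
* §3 KLEIMAN'S FORMS ARE `(-1)ᵏ`-SYMMETRIC, NON-DEGENERATE AND `ℚ`-VALUED: **`compl₂_lefschetzInvolution_apply_of_comm`**
  (`K_L(w, of k x) = (-1)ᵏ K_L(of k x, w)`), `…_of_of_comm`, **`compl₂_lefschetzInvolution_nondegenerate`**,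
  **`eq_zero_of_forall_compl₂_lefschetzInvolution_of_of_eq_zero`** (`K_L` is non-degenerate ON EACH `Hᵏ(X; ℂ)`),
  **`IsNSForm.compl₂_lefschetzInvolution_mem_range_rat`** (`K_L(H•(X; ℚ), H•(X; ℚ)) ⊆ ℚ` for `η ∈ NS(X)`); the same for `∗` (`d = g`).
* §4 THE LEFSCHETZ DECOMPOSITION IS `K`-ORTHOGONAL AND `K` ON A SUMMAND IS THE PRIMITIVE PAIRING:
  **`compl₂_lefschetzInvolution_of_lefschetzPow_of_lefschetzPow_eq_zero`** (`K_L(Lʲχ, L^{j'}χ') = 0` unless the strings of `χ ∈ Pᵐ`, `χ' ∈ P^{m'}`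
  have the same length AND the same position, `m = m' ∧ j = j'`), **`compl₂_lefschetzInvolution_of_of_eq_zero_of_mem_lefschetzSummandForms`**
  (`K_L(Lʲ P^{a-2j}, L^{j'} P^{a-2j'}) = 0` for `j ≠ j'` in Milne's range), **`compl₂_lefschetzInvolution_of_lefschetzPow_of_lefschetzPow`**
  (`K_L(Lʲχ, Lʲχ') = ⟨Lⁿχ, χ'⟩_e` for `χ' ∈ Pᵐ`, `m + n = g`, EVERY position `j ≤ n`), and the `∗`-versions with the sign `(-1)^{m(m+1)/2}`.

## Scope / not here

André's positivity remark for `*_H` is row g49-#3 (`exists_pos_neg_one_pow_mul_torusIntegral_wedge_andreHodgeInvolution`); the identification of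
`⟨Lⁿχ, χ'⟩_e` with the tree's `lefschetzIntersectionForm` (a `torusIntegral` normalisation) is not made here. Only invariant forms of complex tori.
-/

noncomputable section

-- `Module ℂ` / `SMulZeroClass ℂ` synthesis on `E [⋀^Fin k]→L[ℝ] ℂ` (as in `ComplexTorusLefschetzDecomposition`)
set_option maxSynthPendingDepth 3

namespace Literature.Geometry.Kaehler

namespace ComplexTorus

open Module Function Finset
open Literature.LinearAlgebra.Alternating Literature.Algebra.Lie

universe uE

variable {ι : Type*} [Fintype ι] [DecidableEq ι] {E : Type uE} [NormedAddCommGroup E] [NormedSpace ℂ E] [FiniteDimensional ℂ E]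
  [Nontrivial E] (Φ : (ι → ℝ) ≃L[ℝ] E) {η : E [⋀^Fin 2]→L[ℝ] ℝ} (hη : ∀ v : E, v ≠ 0 → ∃ w : E, η ![v, w] ≠ 0) {N : ℕ}

/-! ## §1 Evaluation of Kleiman's forms -/

section Evaluation

/-- **`K_L(of k x, of k y) = ⟨x, (*_L y)_m⟩_e`** for `x, y ∈ Hᵏ(X; ℂ)`, `k + m = N = 2g` (`*_L y ∈ Hᵐ`). [cite: Andre1996Motifs, Prop. 1.2 (p. 11, "la forme bilinéaire `(x, y) ↦ ∫ x ∪ * y`")] -/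
theorem compl₂_lefschetzInvolution_of_of (e : Fin N ≃ ι) {k m : ℕ} (h : k + m = N) (x y : E [⋀^Fin k]→L[ℝ] ℂ) :
    (poincarePairingG Φ e).compl₂ ((hasLefschetzProperty_lefschetzG hη).lefschetzInvolution isZGrading_countingG) (GForm.of k x) (GForm.of k y) =
      poincarePairing Φ e h x ((hasLefschetzProperty_lefschetzG hη).lefschetzInvolution isZGrading_countingG (GForm.of k y) m) := by
  have hN := finrank_complex_mul_two Φ e
  rw [LinearMap.compl₂_apply, lefschetzInvolution_of_eq_of hη (show k + m = 2 * finrank ℂ E by omega) y, poincarePairingG_of_of Φ e h,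
    GForm.of_apply_self]

/-- **Different degrees are `K_L`-orthogonal: `K_L(of k x, of k' y) = 0` for `k ≠ k'`** (`*_L y ∈ H^{2g-k'}` pairs only with `H^{k'}`).
[cite: Andre1996Motifs, Prop. 1.2 (p. 11)] -/
theorem compl₂_lefschetzInvolution_of_of_of_ne (e : Fin N ≃ ι) {k k' : ℕ} (hkk' : k ≠ k') (x : E [⋀^Fin k]→L[ℝ] ℂ) (y : E [⋀^Fin k']→L[ℝ] ℂ) :
    (poincarePairingG Φ e).compl₂ ((hasLefschetzProperty_lefschetzG hη).lefschetzInvolution isZGrading_countingG) (GForm.of k x) (GForm.of k' y) = 0 := by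
  have hN := finrank_complex_mul_two Φ e
  by_cases hk' : k' ≤ 2 * finrank ℂ E
  · rw [LinearMap.compl₂_apply, lefschetzInvolution_of_eq_of hη (show k' + (2 * finrank ℂ E - k') = 2 * finrank ℂ E by omega) y,
      poincarePairingG_of_of_of_ne Φ e (show k + (2 * finrank ℂ E - k') ≠ N by omega)]
  · rw [eq_zero_of_finrank_real_lt y (by rw [finrank_real_of_complex]; omega), GForm.of_zero, LinearMap.compl₂_apply, map_zero, map_zero]

omit [Fintype ι] in
/-- **`K_L(w, *_L w') = B(w, w')`** (`*_L² = 1`). [cite: Andre1996Motifs, §1.1 (p. 10, "involutions") and Prop. 1.2 (p. 11)] -/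
theorem compl₂_lefschetzInvolution_apply_lefschetzInvolution (e : Fin N ≃ ι) (w w' : GForm E ℂ) :
    (poincarePairingG Φ e).compl₂ ((hasLefschetzProperty_lefschetzG hη).lefschetzInvolution isZGrading_countingG) w
        ((hasLefschetzProperty_lefschetzG hη).lefschetzInvolution isZGrading_countingG w') = poincarePairingG Φ e w w' := by
  rw [LinearMap.compl₂_apply, (hasLefschetzProperty_lefschetzG hη).lefschetzInvolution_lefschetzInvolution]

/-- **`K_L(*_L w, w') = B(w, w')`** (`*_L` is a `B`-isometry). [cite: Andre1996Motifs, §1.1 (p. 11, "`*_L` […] auto-adjoint") and Prop. 1.2 (p. 11)] -/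
theorem compl₂_lefschetzInvolution_lefschetzInvolution_apply (e : Fin N ≃ ι) (w w' : GForm E ℂ) :
    (poincarePairingG Φ e).compl₂ ((hasLefschetzProperty_lefschetzG hη).lefschetzInvolution isZGrading_countingG)
        ((hasLefschetzProperty_lefschetzG hη).lefschetzInvolution isZGrading_countingG w) w' = poincarePairingG Φ e w w' := by
  rw [LinearMap.compl₂_apply]
  exact isOrthogonal_poincarePairingG_lefschetzInvolution Φ hη e w w'

/-- **`*_L` is `K_L`-self-adjoint: `K_L(*_L w, w') = K_L(w, *_L w')`** (both are `B(w, w')`). [cite: Andre1996Motifs, §1.1 (pp. 10–11) and Prop. 1.2 (p. 11)] -/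
theorem isSelfAdjoint_compl₂_lefschetzInvolution_lefschetzInvolution (e : Fin N ≃ ι) :
    ((poincarePairingG Φ e).compl₂ ((hasLefschetzProperty_lefschetzG hη).lefschetzInvolution isZGrading_countingG)).IsSelfAdjoint
      ((hasLefschetzProperty_lefschetzG hη).lefschetzInvolution isZGrading_countingG) := fun w w' ↦ by
  rw [compl₂_lefschetzInvolution_lefschetzInvolution_apply Φ hη e, compl₂_lefschetzInvolution_apply_lefschetzInvolution Φ hη e]

/-- **`K_∗(of k x, of k y) = ⟨x, (∗y)_m⟩_e`** for `x, y ∈ Hᵏ(X; ℂ)`, `k + m = N` (Kleiman–Milne's `∗`, any normalisation `d`).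
[cite: Andre1996Motifs, Prop. 1.2 (p. 11, "pour `* = *_L` ou `*_H`")] [cite: Milne1999LefschetzClasses, §5 p. 664] -/
theorem compl₂_hodgeInvolution_of_of (e : Fin N ≃ ι) (d : ℕ) {k m : ℕ} (h : k + m = N) (x y : E [⋀^Fin k]→L[ℝ] ℂ) :
    (poincarePairingG Φ e).compl₂ ((hasLefschetzProperty_lefschetzG hη).hodgeInvolution isZGrading_countingG d) (GForm.of k x) (GForm.of k y) =
      poincarePairing Φ e h x ((hasLefschetzProperty_lefschetzG hη).hodgeInvolution isZGrading_countingG d (GForm.of k y) m) := by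
  have hN := finrank_complex_mul_two Φ e
  rw [LinearMap.compl₂_apply, hodgeInvolution_of_eq_of hη d (show k + m = 2 * finrank ℂ E by omega) y, poincarePairingG_of_of Φ e h,
    GForm.of_apply_self]

/-- **Different degrees are `K_∗`-orthogonal.** [cite: Andre1996Motifs, Prop. 1.2 (p. 11)] [cite: Milne1999LefschetzClasses, §5 p. 664] -/
theorem compl₂_hodgeInvolution_of_of_of_ne (e : Fin N ≃ ι) (d : ℕ) {k k' : ℕ} (hkk' : k ≠ k') (x : E [⋀^Fin k]→L[ℝ] ℂ)
    (y : E [⋀^Fin k']→L[ℝ] ℂ) :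
    (poincarePairingG Φ e).compl₂ ((hasLefschetzProperty_lefschetzG hη).hodgeInvolution isZGrading_countingG d) (GForm.of k x) (GForm.of k' y) = 0 := by
  have hN := finrank_complex_mul_two Φ e
  by_cases hk' : k' ≤ 2 * finrank ℂ E
  · rw [LinearMap.compl₂_apply, hodgeInvolution_of_eq_of hη d (show k' + (2 * finrank ℂ E - k') = 2 * finrank ℂ E by omega) y,
      poincarePairingG_of_of_of_ne Φ e (show k + (2 * finrank ℂ E - k') ≠ N by omega)]
  · rw [eq_zero_of_finrank_real_lt y (by rw [finrank_real_of_complex]; omega), GForm.of_zero, LinearMap.compl₂_apply, map_zero, map_zero]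

omit [Fintype ι] in
/-- **`K_∗(w, ∗w') = B(w, w')`** (`∗² = 1`). [cite: Milne1999LefschetzClasses, §5 p. 664] -/
theorem compl₂_hodgeInvolution_apply_hodgeInvolution (e : Fin N ≃ ι) (d : ℕ) (w w' : GForm E ℂ) :
    (poincarePairingG Φ e).compl₂ ((hasLefschetzProperty_lefschetzG hη).hodgeInvolution isZGrading_countingG d) w
        ((hasLefschetzProperty_lefschetzG hη).hodgeInvolution isZGrading_countingG d w') = poincarePairingG Φ e w w' := by
  rw [LinearMap.compl₂_apply, (hasLefschetzProperty_lefschetzG hη).hodgeInvolution_hodgeInvolution]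

/-- **`∗` is `K_∗`-self-adjoint.** [cite: Milne1999LefschetzClasses, §5 p. 664] [cite: Andre1996Motifs, Prop. 1.2 (p. 11)] -/
theorem isSelfAdjoint_compl₂_hodgeInvolution_hodgeInvolution (e : Fin N ≃ ι) (d : ℕ) :
    ((poincarePairingG Φ e).compl₂ ((hasLefschetzProperty_lefschetzG hη).hodgeInvolution isZGrading_countingG d)).IsSelfAdjoint
      ((hasLefschetzProperty_lefschetzG hη).hodgeInvolution isZGrading_countingG d) := fun w w' ↦ by
  rw [compl₂_hodgeInvolution_apply_hodgeInvolution Φ hη e d, LinearMap.compl₂_apply]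
  exact isOrthogonal_poincarePairingG_hodgeInvolution Φ hη e d w w'

end Evaluation

/-! ## §2 André's Prop. 1.2, last clause: transposition for `K_L` exchanges `L_η` and `ᶜL`; it is matrix transposition -/

section Transposition

omit [Fintype ι] in
/-- **THE `K_L`-TRANSPOSE OF `T` IS `*_L Tᵗ *_L`**, `Tᵗ` a `B`-transpose of `T`: `K_L(T w, w') = K_L(w, (*_L Tᵗ *_L) w')` (`*_L² = 1`).
[cite: Andre1996Motifs, Prop. 1.2 (pp. 11–12, proof: "il suffit de la tester sur les générateurs")] -/
theorem isAdjointPair_compl₂_lefschetzInvolution_of_isAdjointPair (e : Fin N ≃ ι) {T T' : Module.End ℂ (GForm E ℂ)}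
    (hTT' : LinearMap.IsAdjointPair (poincarePairingG Φ e) (poincarePairingG Φ e) T T') :
    LinearMap.IsAdjointPair ((poincarePairingG Φ e).compl₂ ((hasLefschetzProperty_lefschetzG hη).lefschetzInvolution isZGrading_countingG))
      ((poincarePairingG Φ e).compl₂ ((hasLefschetzProperty_lefschetzG hη).lefschetzInvolution isZGrading_countingG)) ⇑T
      ⇑((hasLefschetzProperty_lefschetzG hη).lefschetzInvolution isZGrading_countingG * T' *
        (hasLefschetzProperty_lefschetzG hη).lefschetzInvolution isZGrading_countingG) := fun w w' ↦ by
  rw [LinearMap.compl₂_apply, LinearMap.compl₂_apply, hTT', Module.End.mul_apply, Module.End.mul_apply,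
    (hasLefschetzProperty_lefschetzG hη).lefschetzInvolution_lefschetzInvolution]

omit [Fintype ι] [Nontrivial E] in
/-- **"ces générateurs s'échangent par la transposition", `L ↦ ᶜL`: `K_L(L_η w, w') = K_L(w, (*_L L_η *_L) w')`** (abstract row
`isAdjointPair_compl₂_lefschetzInvolution`, `L_η` self-adjoint for `B`). [cite: Andre1996Motifs, Prop. 1.2 (pp. 11–12)] -/
theorem isAdjointPair_compl₂_lefschetzInvolution_lefschetzG_conj [Nontrivial E] (hη : ∀ v : E, v ≠ 0 → ∃ w : E, η ![v, w] ≠ 0) (e : Fin N ≃ ι) :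
    LinearMap.IsAdjointPair ((poincarePairingG Φ e).compl₂ ((hasLefschetzProperty_lefschetzG hη).lefschetzInvolution isZGrading_countingG))
      ((poincarePairingG Φ e).compl₂ ((hasLefschetzProperty_lefschetzG hη).lefschetzInvolution isZGrading_countingG)) ⇑(lefschetzG η)
      ⇑((hasLefschetzProperty_lefschetzG hη).lefschetzInvolution isZGrading_countingG * lefschetzG η *
        (hasLefschetzProperty_lefschetzG hη).lefschetzInvolution isZGrading_countingG) :=
  (hasLefschetzProperty_lefschetzG hη).isAdjointPair_compl₂_lefschetzInvolution isZGrading_countingG (isSelfAdjoint_poincarePairingG_lefschetzG Φ η e)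

/-- **… and `ᶜL ↦ L`: `K_L((*_L L_η *_L) w, w') = K_L(w, L_η w')`** (abstract row `isAdjointPair_compl₂_lefschetzInvolution'`).
[cite: Andre1996Motifs, Prop. 1.2 (pp. 11–12)] -/
theorem isAdjointPair_compl₂_lefschetzInvolution_conj_lefschetzG (e : Fin N ≃ ι) :
    LinearMap.IsAdjointPair ((poincarePairingG Φ e).compl₂ ((hasLefschetzProperty_lefschetzG hη).lefschetzInvolution isZGrading_countingG))
      ((poincarePairingG Φ e).compl₂ ((hasLefschetzProperty_lefschetzG hη).lefschetzInvolution isZGrading_countingG))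
      ⇑((hasLefschetzProperty_lefschetzG hη).lefschetzInvolution isZGrading_countingG * lefschetzG η *
        (hasLefschetzProperty_lefschetzG hη).lefschetzInvolution isZGrading_countingG) ⇑(lefschetzG η) :=
  (hasLefschetzProperty_lefschetzG hη).isAdjointPair_compl₂_lefschetzInvolution' isZGrading_countingG (isSkewAdjoint_poincarePairingG_countingG Φ e)
    (isSelfAdjoint_poincarePairingG_lefschetzG Φ η e)

/-- **The `K_L`-transpose of `Λ_η` is `*_L Λ_η *_L`** (`Λ_η` is `B`-self-adjoint). [cite: Andre1996Motifs, §1.1 (p. 11) and Prop. 1.2 (pp. 11–12)] -/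
theorem isAdjointPair_compl₂_lefschetzInvolution_lefschetzDualG_conj (e : Fin N ≃ ι) :
    LinearMap.IsAdjointPair ((poincarePairingG Φ e).compl₂ ((hasLefschetzProperty_lefschetzG hη).lefschetzInvolution isZGrading_countingG))
      ((poincarePairingG Φ e).compl₂ ((hasLefschetzProperty_lefschetzG hη).lefschetzInvolution isZGrading_countingG)) ⇑(lefschetzDualG η)
      ⇑((hasLefschetzProperty_lefschetzG hη).lefschetzInvolution isZGrading_countingG * lefschetzDualG η *
        (hasLefschetzProperty_lefschetzG hη).lefschetzInvolution isZGrading_countingG) :=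
  isAdjointPair_compl₂_lefschetzInvolution_of_isAdjointPair Φ hη e (isSelfAdjoint_poincarePairingG_lefschetzDualG Φ hη e)

/-- **The `K_L`-transpose of the Weyl operator `w` is `*_L w *_L`** (`w` is `B`-self-adjoint). [cite: Andre1996Motifs, §1.1–§1.2 (p. 11)] -/
theorem isAdjointPair_compl₂_lefschetzInvolution_weylOperator_conj (e : Fin N ≃ ι) :
    LinearMap.IsAdjointPair ((poincarePairingG Φ e).compl₂ ((hasLefschetzProperty_lefschetzG hη).lefschetzInvolution isZGrading_countingG))
      ((poincarePairingG Φ e).compl₂ ((hasLefschetzProperty_lefschetzG hη).lefschetzInvolution isZGrading_countingG))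
      ⇑((hasLefschetzProperty_lefschetzG hη).weylOperator isZGrading_countingG)
      ⇑((hasLefschetzProperty_lefschetzG hη).lefschetzInvolution isZGrading_countingG * (hasLefschetzProperty_lefschetzG hη).weylOperator isZGrading_countingG *
        (hasLefschetzProperty_lefschetzG hη).lefschetzInvolution isZGrading_countingG) :=
  isAdjointPair_compl₂_lefschetzInvolution_of_isAdjointPair Φ hη e (isSelfAdjoint_poincarePairingG_weylOperator Φ hη e)

/-- **`ℂ[L_η, Λ_η]` IS STABLE UNDER `K_L`-TRANSPOSITION**: every `T ∈ ℂ[L_η, Λ_η]` has a `K_L`-adjoint inside `ℂ[L_η, Λ_η]` (`*_L Tᵗ *_L`, with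
`Tᵗ ∈ ℂ[L_η, Λ_η]` a `B`-adjoint and `*_L ∈ ℂ[L_η, Λ_η]`) — "la transposition relative à la forme bilinéaire `(x, y) ↦ ∫ x ∪ *_L y`" is an
anti-involution OF THE ALGEBRA. [cite: Andre1996Motifs, Prop. 1.2 (pp. 11–12)] -/
theorem exists_mem_adjoin_isAdjointPair_compl₂_lefschetzInvolution (e : Fin N ≃ ι) {T : Module.End ℂ (GForm E ℂ)}
    (hT : T ∈ Algebra.adjoin ℂ ({lefschetzG η, lefschetzDualG η} : Set (Module.End ℂ (GForm E ℂ)))) :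
    ∃ T' ∈ Algebra.adjoin ℂ ({lefschetzG η, lefschetzDualG η} : Set (Module.End ℂ (GForm E ℂ))),
      LinearMap.IsAdjointPair ((poincarePairingG Φ e).compl₂ ((hasLefschetzProperty_lefschetzG hη).lefschetzInvolution isZGrading_countingG))
        ((poincarePairingG Φ e).compl₂ ((hasLefschetzProperty_lefschetzG hη).lefschetzInvolution isZGrading_countingG)) T T' := by
  obtain ⟨T', hT', hTT'⟩ := exists_mem_adjoin_isAdjointPair_poincarePairingG Φ hη e hT
  have hs : (hasLefschetzProperty_lefschetzG hη).lefschetzInvolution isZGrading_countingG ∈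
      Algebra.adjoin ℂ ({lefschetzG η, lefschetzDualG η} : Set (Module.End ℂ (GForm E ℂ))) := by
    rw [← dual_lefschetzG_eq_lefschetzDualG hη]
    exact (hasLefschetzProperty_lefschetzG hη).lefschetzInvolution_mem_adjoin_pair_dual isZGrading_countingG
  exact ⟨_, Subalgebra.mul_mem _ (Subalgebra.mul_mem _ hs hT') hs, isAdjointPair_compl₂_lefschetzInvolution_of_isAdjointPair Φ hη e hTT'⟩

/-- **"LA TRANSPOSITION […] CORRESPOND À LA TRANSPOSITION DES MATRICES" ON THE TORUS, `* = *_L`**: for André's algebra map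
`Φ : Π_{k ∈ stringTypes} M_{k+1}(ℂ) → End H•(X; ℂ)` (p34's `matrixHom`, range `ℂ[L_η, ᶜΛ]`) and every family of matrices `c`,
`Φ(c)` and `Φ(cᵀ)` are mutually `K_L`-adjoint. [cite: Andre1996Motifs, Prop. 1.2 (pp. 11–12)] -/
theorem isAdjointPair_compl₂_lefschetzInvolution_matrixHom_transpose (e : Fin N ≃ ι)
    (c : (k : HasLefschetzProperty.stringTypes (countingG E) (lefschetzG η)) → Matrix (Fin ((k : ℕ) + 1)) (Fin ((k : ℕ) + 1)) ℂ) :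
    LinearMap.IsAdjointPair ((poincarePairingG Φ e).compl₂ ((hasLefschetzProperty_lefschetzG hη).lefschetzInvolution isZGrading_countingG))
      ((poincarePairingG Φ e).compl₂ ((hasLefschetzProperty_lefschetzG hη).lefschetzInvolution isZGrading_countingG))
      ((hasLefschetzProperty_lefschetzG hη).matrixHom isZGrading_countingG c)
      ((hasLefschetzProperty_lefschetzG hη).matrixHom isZGrading_countingG fun k ↦ (c k).transpose) :=
  (hasLefschetzProperty_lefschetzG hη).matrixHom_transpose_isAdjointPair_lefschetzInvolution isZGrading_countingG
    (isSkewAdjoint_poincarePairingG_countingG Φ e) (isSelfAdjoint_poincarePairingG_lefschetzG Φ η e) c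

/-- A family of SYMMETRIC matrices gives a `K_L`-self-adjoint element `Φ(c)` of `ℂ[L_η, ᶜΛ]`. [cite: Andre1996Motifs, Prop. 1.2 (pp. 11–12)] -/
theorem isSelfAdjoint_compl₂_lefschetzInvolution_matrixHom_of_isSymm (e : Fin N ≃ ι)
    {c : (k : HasLefschetzProperty.stringTypes (countingG E) (lefschetzG η)) → Matrix (Fin ((k : ℕ) + 1)) (Fin ((k : ℕ) + 1)) ℂ} (hc : ∀ k, (c k).IsSymm) :
    ((poincarePairingG Φ e).compl₂ ((hasLefschetzProperty_lefschetzG hη).lefschetzInvolution isZGrading_countingG)).IsSelfAdjoint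
      ⇑((hasLefschetzProperty_lefschetzG hη).matrixHom isZGrading_countingG c) :=
  (hasLefschetzProperty_lefschetzG hη).isSelfAdjoint_matrixHom_of_isSymm_lefschetzInvolution isZGrading_countingG
    (isSkewAdjoint_poincarePairingG_countingG Φ e) (isSelfAdjoint_poincarePairingG_lefschetzG Φ η e) hc

omit [Fintype ι] [Nontrivial E] in
/-- **The same for `* = ∗`: `K_∗(L_η w, w') = K_∗(w, (∗ L_η ∗) w')`.** [cite: Andre1996Motifs, Prop. 1.2 (p. 11, "pour `* = *_L` ou `*_H`")]
[cite: Milne1999LefschetzClasses, §5 p. 664] -/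
theorem isAdjointPair_compl₂_hodgeInvolution_lefschetzG_conj [Nontrivial E] (hη : ∀ v : E, v ≠ 0 → ∃ w : E, η ![v, w] ≠ 0) (e : Fin N ≃ ι)
    (d : ℕ) :
    LinearMap.IsAdjointPair ((poincarePairingG Φ e).compl₂ ((hasLefschetzProperty_lefschetzG hη).hodgeInvolution isZGrading_countingG d))
      ((poincarePairingG Φ e).compl₂ ((hasLefschetzProperty_lefschetzG hη).hodgeInvolution isZGrading_countingG d)) ⇑(lefschetzG η)
      ⇑((hasLefschetzProperty_lefschetzG hη).hodgeInvolution isZGrading_countingG d * lefschetzG η *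
        (hasLefschetzProperty_lefschetzG hη).hodgeInvolution isZGrading_countingG d) :=
  (hasLefschetzProperty_lefschetzG hη).isAdjointPair_compl₂_hodgeInvolution isZGrading_countingG d (isSelfAdjoint_poincarePairingG_lefschetzG Φ η e)

/-- **… and `K_∗((∗ L_η ∗) w, w') = K_∗(w, L_η w')`.** [cite: Andre1996Motifs, Prop. 1.2 (pp. 11–12)] [cite: Milne1999LefschetzClasses, §5 p. 664] -/
theorem isAdjointPair_compl₂_hodgeInvolution_conj_lefschetzG (e : Fin N ≃ ι) (d : ℕ) :
    LinearMap.IsAdjointPair ((poincarePairingG Φ e).compl₂ ((hasLefschetzProperty_lefschetzG hη).hodgeInvolution isZGrading_countingG d))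
      ((poincarePairingG Φ e).compl₂ ((hasLefschetzProperty_lefschetzG hη).hodgeInvolution isZGrading_countingG d))
      ⇑((hasLefschetzProperty_lefschetzG hη).hodgeInvolution isZGrading_countingG d * lefschetzG η *
        (hasLefschetzProperty_lefschetzG hη).hodgeInvolution isZGrading_countingG d) ⇑(lefschetzG η) :=
  (hasLefschetzProperty_lefschetzG hη).isAdjointPair_compl₂_hodgeInvolution' isZGrading_countingG d (isSkewAdjoint_poincarePairingG_countingG Φ e)
    (isSelfAdjoint_poincarePairingG_lefschetzG Φ η e)

/-- **"correspond à la transposition des matrices", `* = ∗`.** [cite: Andre1996Motifs, Prop. 1.2 (pp. 11–12, "pour `* = *_L` ou `*_H`")] -/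
theorem isAdjointPair_compl₂_hodgeInvolution_matrixHom_transpose (e : Fin N ≃ ι) (d : ℕ)
    (c : (k : HasLefschetzProperty.stringTypes (countingG E) (lefschetzG η)) → Matrix (Fin ((k : ℕ) + 1)) (Fin ((k : ℕ) + 1)) ℂ) :
    LinearMap.IsAdjointPair ((poincarePairingG Φ e).compl₂ ((hasLefschetzProperty_lefschetzG hη).hodgeInvolution isZGrading_countingG d))
      ((poincarePairingG Φ e).compl₂ ((hasLefschetzProperty_lefschetzG hη).hodgeInvolution isZGrading_countingG d))
      ((hasLefschetzProperty_lefschetzG hη).matrixHom isZGrading_countingG c)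
      ((hasLefschetzProperty_lefschetzG hη).matrixHom isZGrading_countingG fun k ↦ (c k).transpose) :=
  (hasLefschetzProperty_lefschetzG hη).matrixHom_transpose_isAdjointPair_hodgeInvolution isZGrading_countingG d
    (isSkewAdjoint_poincarePairingG_countingG Φ e) (isSelfAdjoint_poincarePairingG_lefschetzG Φ η e) c

end Transposition

/-! ## §3 Kleiman's forms are `(-1)ᵏ`-symmetric, non-degenerate and `ℚ`-valued -/

section Symmetry

omit [Fintype ι] [FiniteDimensional ℂ E] [Nontrivial E] in
/-- `(-1)ᵐ = (-1)ᵏ` for `k + m` even. [folklore] -/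
private theorem neg_one_pow_eq_of_add_eq_two_mul {k m g : ℕ} (h : k + m = 2 * g) : (-1 : ℂ) ^ m = (-1) ^ k := by
  have h3 : (-1 : ℂ) ^ m * (-1) ^ k = (-1) ^ k * (-1) ^ k := by
    rw [← pow_add, ← pow_add, show m + k = 2 * g by omega, ← two_mul, pow_mul, pow_mul, neg_one_sq, one_pow, one_pow]
  exact mul_right_cancel₀ (pow_ne_zero k (neg_ne_zero.2 one_ne_zero)) h3

/-- **KLEIMAN'S FORM IS `(-1)ᵏ`-SYMMETRIC: `K_L(w, of k x) = (-1)ᵏ K_L(of k x, w)`** for a homogeneous class `x` of degree `k` and every `w`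
(`*_L x ∈ H^{2g-k}`, graded symmetry of `B`, `*_L` self-adjoint, `(-1)^{2g-k} = (-1)ᵏ`): symmetric on the even cohomology, antisymmetric on the odd.
[cite: Andre1996Motifs, §1.1 (p. 11) and Prop. 1.2 (p. 11)] [cite: Kleiman1968AlgebraicCycles, §1.4 and §3] -/
theorem compl₂_lefschetzInvolution_apply_of_comm (e : Fin N ≃ ι) {k : ℕ} (x : E [⋀^Fin k]→L[ℝ] ℂ) (w : GForm E ℂ) :
    (poincarePairingG Φ e).compl₂ ((hasLefschetzProperty_lefschetzG hη).lefschetzInvolution isZGrading_countingG) w (GForm.of k x) =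
      (-1) ^ k * (poincarePairingG Φ e).compl₂ ((hasLefschetzProperty_lefschetzG hη).lefschetzInvolution isZGrading_countingG) (GForm.of k x) w := by
  have hN := finrank_complex_mul_two Φ e
  by_cases hk : k ≤ 2 * finrank ℂ E
  · have hkm : k + (2 * finrank ℂ E - k) = 2 * finrank ℂ E := by omega
    rw [LinearMap.compl₂_apply, LinearMap.compl₂_apply, lefschetzInvolution_of_eq_of hη hkm x, poincarePairingG_apply_of_comm,
      ← lefschetzInvolution_of_eq_of hη hkm x, isSelfAdjoint_poincarePairingG_lefschetzInvolution Φ hη e (GForm.of k x) w,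
      neg_one_pow_eq_of_add_eq_two_mul hkm]
  · rw [eq_zero_of_finrank_real_lt x (by rw [finrank_real_of_complex]; omega), GForm.of_zero, map_zero, map_zero, LinearMap.zero_apply, mul_zero]

/-- Homogeneous form: `K_L(of k' y, of k x) = (-1)ᵏ K_L(of k x, of k' y)`. [cite: Andre1996Motifs, Prop. 1.2 (p. 11)] [cite: Kleiman1968AlgebraicCycles, §1.4] -/
theorem compl₂_lefschetzInvolution_of_of_comm (e : Fin N ≃ ι) {k k' : ℕ} (x : E [⋀^Fin k]→L[ℝ] ℂ) (y : E [⋀^Fin k']→L[ℝ] ℂ) :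
    (poincarePairingG Φ e).compl₂ ((hasLefschetzProperty_lefschetzG hη).lefschetzInvolution isZGrading_countingG) (GForm.of k' y) (GForm.of k x) =
      (-1) ^ k * (poincarePairingG Φ e).compl₂ ((hasLefschetzProperty_lefschetzG hη).lefschetzInvolution isZGrading_countingG) (GForm.of k x)
        (GForm.of k' y) :=
  compl₂_lefschetzInvolution_apply_of_comm Φ hη e x (GForm.of k' y)

omit [Fintype ι] in
/-- **`K_L` IS NON-DEGENERATE on `H•(X; ℂ)`** (`B` is, and `*_L` is invertible). [cite: Andre1996Motifs, Prop. 1.2 (p. 11)]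
[cite: Lange2023AbelianVarietiesComplex, §6.2.4 (p. 310)] -/
theorem compl₂_lefschetzInvolution_nondegenerate [Fintype ι] (e : Fin N ≃ ι) :
    ((poincarePairingG Φ e).compl₂ ((hasLefschetzProperty_lefschetzG hη).lefschetzInvolution isZGrading_countingG)).Nondegenerate := by
  obtain ⟨hl, hr⟩ := poincarePairingG_nondegenerate Φ e
  refine ⟨fun w hw ↦ hl w fun w' ↦ ?_, fun w' hw ↦ ?_⟩
  · have h1 := hw ((hasLefschetzProperty_lefschetzG hη).lefschetzInvolution isZGrading_countingG w')
    rwa [compl₂_lefschetzInvolution_apply_lefschetzInvolution Φ hη e] at h1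
  · have h1 : (hasLefschetzProperty_lefschetzG hη).lefschetzInvolution isZGrading_countingG w' = 0 := hr _ fun w ↦ by
      have h2 := hw w
      rwa [LinearMap.compl₂_apply] at h2
    rw [← (hasLefschetzProperty_lefschetzG hη).lefschetzInvolution_lefschetzInvolution isZGrading_countingG w', h1, map_zero]

/-- **`K_L` IS NON-DEGENERATE ON EACH `Hᵏ(X; ℂ)`**: `K_L(of k x, of k y) = 0` for all `y ∈ Hᵏ` forces `x = 0` (`*_L : Hᵏ ⥲ H^{2g-k}` and Poincaré
duality `Hᵏ × H^{2g-k} → ℂ`). [cite: Andre1996Motifs, Prop. 1.2 (p. 11)] [cite: Lange2023AbelianVarietiesComplex, §6.2.4 (p. 310)] -/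
theorem eq_zero_of_forall_compl₂_lefschetzInvolution_of_of_eq_zero (e : Fin N ≃ ι) {k : ℕ} {x : E [⋀^Fin k]→L[ℝ] ℂ}
    (hx : ∀ y : E [⋀^Fin k]→L[ℝ] ℂ, (poincarePairingG Φ e).compl₂ ((hasLefschetzProperty_lefschetzG hη).lefschetzInvolution isZGrading_countingG)
      (GForm.of k x) (GForm.of k y) = 0) : x = 0 := by
  have hN := finrank_complex_mul_two Φ e
  by_cases hk : k ≤ 2 * finrank ℂ E
  · have hkm : k + (2 * finrank ℂ E - k) = 2 * finrank ℂ E := by omega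
    have hmk : (2 * finrank ℂ E - k) + k = 2 * finrank ℂ E := by omega
    refine eq_zero_of_forall_right_poincarePairing_eq_zero Φ e (show k + (2 * finrank ℂ E - k) = N by omega) fun z ↦ ?_
    set L := hasLefschetzProperty_lefschetzG hη with hL
    -- `z = (*_L y)_m` for `y = (*_L z)_k`
    have h1 := hx (L.lefschetzInvolution isZGrading_countingG (GForm.of (2 * finrank ℂ E - k) z) k)
    rwa [compl₂_lefschetzInvolution_of_of Φ hη e (show k + (2 * finrank ℂ E - k) = N by omega), ← lefschetzInvolution_of_eq_of hη hmk z,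
      L.lefschetzInvolution_lefschetzInvolution isZGrading_countingG, GForm.of_apply_self] at h1
  · exact eq_zero_of_finrank_real_lt x (by rw [finrank_real_of_complex]; omega)

/-- **`K_L(H•(X; ℚ), H•(X; ℚ)) ⊆ ℚ` for every non-degenerate `η ∈ NS(X)`** (`*_L ∈ 𝔤𝔩(H•(X; ℚ))`, row g50-#6, and `B` is `ℚ`-valued on rational
classes): Kleiman's form is DEFINED OVER `ℚ`. [cite: Andre1996Motifs, Prop. 1.2 (p. 11, "`ℚ[L, *_L]` […] de `End H*(X)`")]
[cite: Milne1999LefschetzClasses, §5 p. 665 (proof of Thm. 5.9)] -/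
theorem IsNSForm.compl₂_lefschetzInvolution_mem_range_rat (hNS : IsNSForm Φ η) (hη : ∀ v : E, v ≠ 0 → ∃ w : E, η ![v, w] ≠ 0) (e : Fin N ≃ ι)
    {w w' : GForm E ℂ} (hw : w ∈ rationalFormsG Φ) (hw' : w' ∈ rationalFormsG Φ) :
    ∃ q : ℚ, (poincarePairingG Φ e).compl₂ ((hasLefschetzProperty_lefschetzG hη).lefschetzInvolution isZGrading_countingG) w w' = q := by
  rw [LinearMap.compl₂_apply]
  exact poincarePairingG_mem_range_rat Φ e hw ((hNS.lefschetzInvolution_mem_rationalEnd Φ hη) w' hw')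

/-- **`K_∗(w, of k x) = (-1)ᵏ K_∗(of k x, w)`** (Kleiman–Milne's `∗`, any `d`). [cite: Kleiman1968AlgebraicCycles, §1.4 and §3] [cite: Milne1999LefschetzClasses, §5 p. 664] -/
theorem compl₂_hodgeInvolution_apply_of_comm (e : Fin N ≃ ι) (d : ℕ) {k : ℕ} (x : E [⋀^Fin k]→L[ℝ] ℂ) (w : GForm E ℂ) :
    (poincarePairingG Φ e).compl₂ ((hasLefschetzProperty_lefschetzG hη).hodgeInvolution isZGrading_countingG d) w (GForm.of k x) =
      (-1) ^ k * (poincarePairingG Φ e).compl₂ ((hasLefschetzProperty_lefschetzG hη).hodgeInvolution isZGrading_countingG d) (GForm.of k x) w := by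
  have hN := finrank_complex_mul_two Φ e
  by_cases hk : k ≤ 2 * finrank ℂ E
  · have hkm : k + (2 * finrank ℂ E - k) = 2 * finrank ℂ E := by omega
    rw [LinearMap.compl₂_apply, LinearMap.compl₂_apply, hodgeInvolution_of_eq_of hη d hkm x, poincarePairingG_apply_of_comm,
      ← hodgeInvolution_of_eq_of hη d hkm x, isSelfAdjoint_poincarePairingG_hodgeInvolution Φ hη e d (GForm.of k x) w,
      neg_one_pow_eq_of_add_eq_two_mul hkm]
  · rw [eq_zero_of_finrank_real_lt x (by rw [finrank_real_of_complex]; omega), GForm.of_zero, map_zero, map_zero, LinearMap.zero_apply, mul_zero]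

omit [Fintype ι] in
/-- **`K_∗` IS NON-DEGENERATE on `H•(X; ℂ)`.** [cite: Milne1999LefschetzClasses, §5 p. 664] [cite: Lange2023AbelianVarietiesComplex, §6.2.4 (p. 310)] -/
theorem compl₂_hodgeInvolution_nondegenerate [Fintype ι] (e : Fin N ≃ ι) (d : ℕ) :
    ((poincarePairingG Φ e).compl₂ ((hasLefschetzProperty_lefschetzG hη).hodgeInvolution isZGrading_countingG d)).Nondegenerate := by
  obtain ⟨hl, hr⟩ := poincarePairingG_nondegenerate Φ e
  refine ⟨fun w hw ↦ hl w fun w' ↦ ?_, fun w' hw ↦ ?_⟩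
  · have h1 := hw ((hasLefschetzProperty_lefschetzG hη).hodgeInvolution isZGrading_countingG d w')
    rwa [compl₂_hodgeInvolution_apply_hodgeInvolution Φ hη e d] at h1
  · have h1 : (hasLefschetzProperty_lefschetzG hη).hodgeInvolution isZGrading_countingG d w' = 0 := hr _ fun w ↦ by
      have h2 := hw w
      rwa [LinearMap.compl₂_apply] at h2
    rw [← (hasLefschetzProperty_lefschetzG hη).hodgeInvolution_hodgeInvolution isZGrading_countingG d w', h1, map_zero]

/-- **`K_∗(H•(X; ℚ), H•(X; ℚ)) ⊆ ℚ`** for every non-degenerate `η ∈ NS(X)` (`∗` normalised by `d = g` is defined over `ℚ`, row g50-#6).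
[cite: Milne1999LefschetzClasses, §5 p. 665 (proof of Thm. 5.9)] [cite: Kleiman1968AlgebraicCycles, §1.4, 1.4.4] -/
theorem IsNSForm.compl₂_hodgeInvolution_mem_range_rat (hNS : IsNSForm Φ η) (hη : ∀ v : E, v ≠ 0 → ∃ w : E, η ![v, w] ≠ 0) (e : Fin N ≃ ι)
    {w w' : GForm E ℂ} (hw : w ∈ rationalFormsG Φ) (hw' : w' ∈ rationalFormsG Φ) :
    ∃ q : ℚ, (poincarePairingG Φ e).compl₂ ((hasLefschetzProperty_lefschetzG hη).hodgeInvolution isZGrading_countingG (finrank ℂ E)) w w' = q := by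
  rw [LinearMap.compl₂_apply]
  exact poincarePairingG_mem_range_rat Φ e hw ((hNS.hodgeInvolution_mem_rationalEnd Φ hη) w' hw')

end Symmetry

/-! ## §4 The Lefschetz decomposition is orthogonal for Kleiman's forms; on a summand they are the primitive pairing -/

section Lefschetz

/-- **STRINGS OF DIFFERENT LENGTH OR DIFFERENT POSITION ARE `K_L`-ORTHOGONAL: `K_L(of a (Lʲχ), of a' (L^{j'}χ')) = 0` unless
`m = m' ∧ j = j'`** (`χ ∈ Pᵐ`, `χ' ∈ P^{m'}`, `m + n = g = m' + n'`, `j' ≤ n'`, any `j`): `*_L(L^{j'}χ') = L^{n'-j'}χ'` and `B(Lʲχ, L^{n'-j'}χ')`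
vanishes unless the strings have the same length `n = n'` and complementary positions `j + (n' - j') = n` (abstract row
`apply_pow_primitive_pow_primitive_eq_zero`). For `B` itself `Lʲ Pᵐ` pairs with `L^{n-j} Pᵐ`; the twist by `*_L` makes the decomposition ORTHOGONAL.
[cite: Andre1996Motifs, §1.1 (p. 11) and Prop. 1.2 (pp. 11–12, proof)] [cite: Kleiman1968AlgebraicCycles, §1.4] -/
theorem compl₂_lefschetzInvolution_of_lefschetzPow_of_lefschetzPow_eq_zero (e : Fin N ≃ ι) {g : ℕ} (hg : finrank ℂ E = g) {m n m' n' : ℕ}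
    (hmn : m + n = g) (hmn' : m' + n' = g) {χ : E [⋀^Fin m]→L[ℝ] ℂ} (hχ : χ ∈ primitiveForms η m) {χ' : E [⋀^Fin m']→L[ℝ] ℂ}
    (hχ' : χ' ∈ primitiveForms η m') {j j' a a' : ℕ} (hj' : j' ≤ n') (ha : 2 * j + m = a) (ha' : 2 * j' + m' = a')
    (hne : ¬(m = m' ∧ j = j')) :
    (poincarePairingG Φ e).compl₂ ((hasLefschetzProperty_lefschetzG hη).lefschetzInvolution isZGrading_countingG) (GForm.of a (lefschetzPow η j ha χ))
      (GForm.of a' (lefschetzPow η j' ha' χ')) = 0 := by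
  set L := hasLefschetzProperty_lefschetzG hη with hL
  have hp := of_mem_primitiveSpace_of_mem_primitiveForms hη (n := n) (by omega) hχ
  have hp' := of_mem_primitiveSpace_of_mem_primitiveForms hη (n := n') (by omega) hχ'
  rw [LinearMap.compl₂_apply, ← lefschetzG_pow_of η j ha χ, ← lefschetzG_pow_of η j' ha' χ', L.isStringReversal_lefschetzInvolution isZGrading_countingG hp' hj']
  exact apply_pow_primitive_pow_primitive_eq_zero L (isSkewAdjoint_poincarePairingG_countingG Φ e) (isSelfAdjoint_poincarePairingG_lefschetzG Φ η e)
    hp hp' fun h ↦ hne ⟨by omega, by omega⟩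

/-- **THE LEFSCHETZ DECOMPOSITION `Hᵃ(X; ℂ) = ⊕_j Lʲ P^{a-2j}` IS `K_L`-ORTHOGONAL: `K_L(of a x, of a y) = 0` for `x ∈ Lʲ P^{a-2j}`, `y ∈ L^{j'} P^{a-2j'}`,
`j ≠ j'`** in Milne's range `a ≤ g + j`, `a ≤ g + j'` (the summands with `2j > a` are zero).
[cite: Andre1996Motifs, Prop. 1.2 (pp. 11–12)] [cite: Kleiman1968AlgebraicCycles, §1.4] [cite: Milne1999LefschetzClasses, §5 p. 664] -/
theorem compl₂_lefschetzInvolution_of_of_eq_zero_of_mem_lefschetzSummandForms (e : Fin N ≃ ι) {a j j' : ℕ} (haj : a ≤ finrank ℂ E + j)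
    (haj' : a ≤ finrank ℂ E + j') (hne : j ≠ j') {x y : E [⋀^Fin a]→L[ℝ] ℂ} (hx : x ∈ lefschetzSummandForms η a j)
    (hy : y ∈ lefschetzSummandForms η a j') :
    (poincarePairingG Φ e).compl₂ ((hasLefschetzProperty_lefschetzG hη).lefschetzInvolution isZGrading_countingG) (GForm.of a x) (GForm.of a y) = 0 := by
  by_cases h2j : 2 * j ≤ a
  swap
  · rw [eq_zero_of_mem_lefschetzSummandForms η (by omega) hx, GForm.of_zero, map_zero, LinearMap.zero_apply]
  by_cases h2j' : 2 * j' ≤ a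
  swap
  · rw [eq_zero_of_mem_lefschetzSummandForms η (by omega) hy, GForm.of_zero, map_zero]
  rw [lefschetzSummandForms_eq η (show 2 * j + (a - 2 * j) = a by omega)] at hx
  rw [lefschetzSummandForms_eq η (show 2 * j' + (a - 2 * j') = a by omega)] at hy
  obtain ⟨χ, hχ, rfl⟩ := hx
  obtain ⟨χ', hχ', rfl⟩ := hy
  exact compl₂_lefschetzInvolution_of_lefschetzPow_of_lefschetzPow_eq_zero Φ hη e rfl (n := finrank ℂ E + 2 * j - a) (n' := finrank ℂ E + 2 * j' - a)
    (by omega) (by omega) hχ hχ' (by omega) _ _ fun h ↦ hne h.2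

omit [Fintype ι] in
/-- **ON A LEFSCHETZ SUMMAND KLEIMAN'S FORM IS THE PRIMITIVE PAIRING, INDEPENDENTLY OF THE POSITION: `K_L(of a (Lʲχ), of a (Lʲχ')) = ⟨Lⁿχ, χ'⟩_e`**
for `χ' ∈ Pᵐ`, `m + n = g`, every `j ≤ n` (`a = m + 2j`, `b = m + 2n = 2g - m`; `χ` any `m`-form): `*_L(Lʲχ') = L^{n-j}χ'` and
`B(Lʲχ, L^{n-j}χ') = B(Lⁿχ, χ')` (`L_η` self-adjoint). [cite: Andre1996Motifs, §1.1 (p. 11) and Prop. 1.2 (pp. 11–12, proof)]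
[cite: Kleiman1968AlgebraicCycles, §1.4 and §3] -/
theorem compl₂_lefschetzInvolution_of_lefschetzPow_of_lefschetzPow (e : Fin N ≃ ι) {g : ℕ} (hg : finrank ℂ E = g) {m n : ℕ} (hmn : m + n = g)
    (χ : E [⋀^Fin m]→L[ℝ] ℂ) {χ' : E [⋀^Fin m]→L[ℝ] ℂ} (hχ' : χ' ∈ primitiveForms η m) {j a b : ℕ} (hj : j ≤ n) (ha : 2 * j + m = a)
    (hb : 2 * n + m = b) (h : b + m = N) :
    (poincarePairingG Φ e).compl₂ ((hasLefschetzProperty_lefschetzG hη).lefschetzInvolution isZGrading_countingG) (GForm.of a (lefschetzPow η j ha χ))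
      (GForm.of a (lefschetzPow η j ha χ')) = poincarePairing Φ e h (lefschetzPow η n hb χ) χ' := by
  set L := hasLefschetzProperty_lefschetzG hη with hL
  have hp' := of_mem_primitiveSpace_of_mem_primitiveForms hη (n := n) (by omega) hχ'
  rw [LinearMap.compl₂_apply, ← lefschetzG_pow_of η j ha χ, ← lefschetzG_pow_of η j ha χ', L.isStringReversal_lefschetzInvolution isZGrading_countingG hp' hj,
    apply_pow_primitive_pow_primitive_eq (isSelfAdjoint_poincarePairingG_lefschetzG Φ η e) (show j + (n - j) = n by omega),
    lefschetzG_pow_of η n hb χ, poincarePairingG_of_of Φ e h]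

/-- **The `∗`-version: `K_∗(of a (Lʲχ), of a' (L^{j'}χ')) = 0` unless `m = m' ∧ j = j'`** (`∗(L^{j'}χ') = ±L^{n'-j'}χ'`, normalisation `d`).
[cite: Milne1999LefschetzClasses, §5 p. 664] [cite: Kleiman1968AlgebraicCycles, §1.4] -/
theorem compl₂_hodgeInvolution_of_lefschetzPow_of_lefschetzPow_eq_zero (e : Fin N ≃ ι) (d : ℕ) {g : ℕ} (hg : finrank ℂ E = g) {m n m' n' : ℕ}
    (hmn : m + n = g) (hmn' : m' + n' = g) {χ : E [⋀^Fin m]→L[ℝ] ℂ} (hχ : χ ∈ primitiveForms η m) {χ' : E [⋀^Fin m']→L[ℝ] ℂ}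
    (hχ' : χ' ∈ primitiveForms η m') {j j' a a' : ℕ} (hj' : j' ≤ n') (ha : 2 * j + m = a) (ha' : 2 * j' + m' = a')
    (hne : ¬(m = m' ∧ j = j')) :
    (poincarePairingG Φ e).compl₂ ((hasLefschetzProperty_lefschetzG hη).hodgeInvolution isZGrading_countingG d) (GForm.of a (lefschetzPow η j ha χ))
      (GForm.of a' (lefschetzPow η j' ha' χ')) = 0 := by
  set L := hasLefschetzProperty_lefschetzG hη with hL
  have hp := of_mem_primitiveSpace_of_mem_primitiveForms hη (n := n) (by omega) hχ
  have hp' := of_mem_primitiveSpace_of_mem_primitiveForms hη (n := n') (by omega) hχ'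
  rw [LinearMap.compl₂_apply, ← lefschetzG_pow_of η j ha χ, ← lefschetzG_pow_of η j' ha' χ', L.hodgeInvolution_apply_pow_primitive isZGrading_countingG d hp' hj',
    map_smul, smul_eq_mul]
  rw [apply_pow_primitive_pow_primitive_eq_zero L (isSkewAdjoint_poincarePairingG_countingG Φ e) (isSelfAdjoint_poincarePairingG_lefschetzG Φ η e)
    hp hp' fun h ↦ hne ⟨by omega, by omega⟩, mul_zero]

omit [Fintype ι] in
/-- **The `∗`-version on a summand: `K_∗(of a (Lʲχ), of a (Lʲχ')) = (-1)^{m(m+1)/2} ⟨Lⁿχ, χ'⟩_e`** for `χ' ∈ Pᵐ`, `m + n = g`, `j ≤ n`, normalisation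
`d = g` (`∗(Lʲχ') = (-1)^{m(m+1)/2} L^{n-j}χ'`). [cite: Milne1999LefschetzClasses, §5 p. 664 (p0026 L55–L70)] [cite: Kleiman1968AlgebraicCycles, §1.4 and §3] -/
theorem compl₂_hodgeInvolution_of_lefschetzPow_of_lefschetzPow (e : Fin N ≃ ι) {g : ℕ} (hg : finrank ℂ E = g) {m n : ℕ} (hmn : m + n = g)
    (χ : E [⋀^Fin m]→L[ℝ] ℂ) {χ' : E [⋀^Fin m]→L[ℝ] ℂ} (hχ' : χ' ∈ primitiveForms η m) {j a b : ℕ} (hj : j ≤ n) (ha : 2 * j + m = a)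
    (hb : 2 * n + m = b) (h : b + m = N) :
    (poincarePairingG Φ e).compl₂ ((hasLefschetzProperty_lefschetzG hη).hodgeInvolution isZGrading_countingG g) (GForm.of a (lefschetzPow η j ha χ))
      (GForm.of a (lefschetzPow η j ha χ')) = (-1 : ℂ) ^ (m * (m + 1) / 2) * poincarePairing Φ e h (lefschetzPow η n hb χ) χ' := by
  set L := hasLefschetzProperty_lefschetzG hη with hL
  have hp' := of_mem_primitiveSpace_of_mem_primitiveForms hη (n := n) (by omega) hχ'
  rw [LinearMap.compl₂_apply, ← lefschetzG_pow_of η j ha χ, ← lefschetzG_pow_of η j ha χ', L.hodgeInvolution_apply_pow_primitive isZGrading_countingG g hp' hj,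
    map_smul, smul_eq_mul, show g - n = m by omega,
    apply_pow_primitive_pow_primitive_eq (isSelfAdjoint_poincarePairingG_lefschetzG Φ η e) (show j + (n - j) = n by omega),
    lefschetzG_pow_of η n hb χ, poincarePairingG_of_of Φ e h]

end Lefschetz

end ComplexTorus

end Literature.Geometry.Kaehler

end
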